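import Mathlib
import HarnessLib
import Literature.Combinatorics.AssociationSchemes.Basic
import Summits.MatrixMultiplication.MatrixMultiplication.Theses.CommutativeSchemes
import Summits.MatrixMultiplication.MatrixMultiplication.Theorems.CommutativeSchemesCommutativeRealizationStubTranslationSchemeIsCommutative
import Summits.MatrixMultiplication.MatrixMultiplication.Theorems.CommutativeSchemesCommutativeRealizationStubCommutativeRealizationCube

/-!
# Crux `CommutativeRealization` (stmt-MatrixMultiplication-9462) — `Lines/birth.lean`, the BC3 birth skeleton

Route `CommutativeSchemes` (route-MatrixMultiplication-CommutativeSchemes; deciding theorem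
`closes : CommutativeRealization → RealizationSRank → WeightRemoval → MatrixMultiplication`, with
`RealizationSRank` proved): the crux is Cohn–Umans 2013 Conjecture 21 in ε-form — for every `ε > 0` some
COMMUTATIVE association scheme with at most `n^(2+ε)` classes realises `⟨n,n,n⟩` (`n ≥ 2`), the scheme
axioms and CU13 Def. 11/12 being inlined in the route file.

THE LINE = TRANSLATION SCHEMES (S-rings over finite abelian groups), the host family CU13 itself points to
(§6.2, p. 15: the configurations of Thm. 20 and those "we conjecture capable of proving ω = 2" are symmetric
powers of abelian group schemes, i.e. the Schurian schemes of `S_k ⋉ G^k` on `G^k` — translation schemes on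
the abelian group `G^k`) and the route header's declared residual positive class ("TWO-LAYER PLAN.
CommutativeRealization ⇐ TranslationRealization (Conj. 21 for S-rings over finite abelian groups)"), cut along
the CU13 architecture RECTANGULAR REALISATION → DIRECT-PRODUCT CUBE → SQUARE (proof of Thm. 17, first paragraph:
"𝒞^k realizes ⟨L, M, N⟩"), in the vendored vocabulary `Literature.Combinatorics.AssociationSchemes`
(`AssociationScheme X ι`, `IsCommutative`, `Realizes`; the route's inlined clauses are these by
`isCommutative_iff` / `realizes_iff`):

* `stub_rectangularTranslationDesign` — THE LOAD-BEARING OPEN STUB (XL): for every `ε > 0` a translation scheme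
  (an association scheme on a finite abelian group `H` whose classes are invariant under `(x, y) ↦ (x+w, y+w)`,
  BCN §2.10; equivalently an S-partition `f : H → Fin r`, `cls x y = f (y - x)`) realising SOME rectangular
  `⟨l, m, n⟩`, `l·m·n ≥ 2`, with at most `(l·m·n)^((2+ε)/3)` class labels. It is CU13 Conj. 21 restricted to
  the translation class and relaxed to rectangular shapes at the cube-root exponent; every construction on
  record (CU13 Thm. 20: ω_s ≤ 2.48, 2.41, 2.376) is of this form with a fixed ε. Transfer C⁺: the host is an
  ADDITIVE object — blocks `D_i = f⁻¹(i)` of a partition of `H`, classes `i, j, k` a triangle iff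
  `0 ∈ D_i + D_j + D_k`, so a design is a "fuzzy TPP" of partition blocks — which is what cyclotomic / orbit
  S-ring constructions (`Cyc(N, K)`, crux `CyclicRealization`, card fuzzy-tpp-cyclotomic-schur-rings), the
  polynomial method and exhaustive search (route CHEAPEST FALSIFIER (2)) act on; general commutative schemes
  offer no such handle.
* `stub_translationScheme_isCommutative` — translation schemes are commutative (BCN §2.10; the involution
  `z ↦ x + y - z` swaps `{z | cls x z = a, cls z y = b}` and `{z | cls x z = b, cls z y = a}` because
  `cls u v` depends only on `v - u`). Provable now, size S/M; it is where commutativity — the one property the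
  assembly `closes` consumes through `RealizationSRank` — enters the line.
* `stub_commutativeRealization_cube` — CU13 §4.2 direct product + proof of Thm. 17 (¶1) + the cyclic symmetry of
  Def. 11: if a commutative scheme `S` on `X` with labels `Fin r` realises `⟨l, m, n⟩` then a commutative scheme
  on `X × X × X` with at most `r³` labels (the direct product of the three rotations of `S`) realises the cube
  `⟨lmn, lmn, lmn⟩` (reindex `Fin l × Fin m × Fin n ≃ Fin (lmn)`). Provable now, size M/L (product scheme:
  intersection numbers multiply; realisation: componentwise triangles; bookkeeping of the equivalences).
* `CommutativeRealization_of_stubs` — the composition WITH EXPLICIT HYPOTHESES (the BC3 shape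
  `stub₁-sig → stub₂-sig → stub₃-sig → crux`, conclusion = the crux statement verbatim, unfolded one step so that
  `CommutativeRealization_of` is the file's only theorem whose head is the crux name): sorry-free, it does the
  real-exponent bookkeeping `r' ≤ r³ ≤ ((lmn)^((2+ε)/3))³ = (lmn)^(2+ε)` and unpacks the scheme structure into
  the route's inlined clauses (`cls_eq_cls_self_iff`, `exists_transpose`, `isCommutative_iff`, `Realizes` by
  `Iff.rfl`).
* `CommutativeRealization_of : CommutativeRealization` — THE skeleton theorem: the crux BY NAME from the three
  declared stubs (`sorry` occurs ONLY inside the three `stub_*`).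

Honest status. Stub 1 carries the whole open difficulty (it implies the crux through stubs 2–3 and is not
known to follow from it: a commutative scheme need not be a translation scheme); the skeleton's content is the
typed reduction "Conj. 21 ⇐ rectangular translation designs at exponent (2+ε)/3", which frees constructors
from squaring/uniformising (the landed `stppTransfer_proof` spends its Steps 1–2 on exactly that) and names
the additive object to be built. Disproof used: none exists — `ledger crux ls stmt-MatrixMultiplication-9462`
showed no workfiles (no `Disproof.lean`, no `Negative/`) on 2026-08-17, and `ledger negatives --problem
MatrixMultiplication` (7 refuted statements, 2026-08-17) has none about association or translation schemes or
realisation (nearest: `not_RectangularThmB`, stmt-10597, a bounded-exponent abelian STPP bound — no scheme, no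
fusion; stub 1 does not bound the exponent of `H`). Kills inherited from
the route: `MetricNoGain` does not refute stub 1 (metric ≠ translation in general; Hamming schemes `H(D,q)` are
both — `q ≥ 3` is dead by `HammingNoGo`, and `MetricNoGain` would merely exclude the metric ones among the
translation hosts); a translation-class lower bound — some fixed `ε₀ > 0`
such that every translation scheme realising `⟨l,m,n⟩` with `lmn` large has more than `(lmn)^((2+ε₀)/3)` classes
(e.g. from a slice-rank / sum–product argument that survives fusion) — refutes stub 1 WITHOUT refuting the crux
(non-translation commutative schemes would remain); `ω(ℂ) > 2` refutes both via `closes`.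

BC3 record (raw outputs in the seat's NOTES.md `## birth-certificate`): `lean check` rc 0, errors [], warnings =
3 × "declaration uses `sorry`" (the three `stub_*`), sorries 3 = stubs 3, zero elsewhere
(`CommutativeRealization_of_stubs` closed = true in the file audit); probes `stub → CommutativeRealization` and
`stub → MatrixMultiplication` by `first | exact? | simpa | aesop` and by the extended battery
(`simpa using h | simpa [C] using h | (unfold C; simpa using h) | aesop`), importing the route file but NOT this
skeleton: 12/12 FAIL; converses `CommutativeRealization → stub` 3/3 FAIL; `stub` alone by `exact? | simp | aesop`
3/3 FAIL (no stub is a library/tree theorem by name).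
-/

-- `Summit.<Summit>.<Problem>`: for the single-conjunct summit the duplicate component is mandated.
set_option linter.dupNamespace false

namespace Summit.MatrixMultiplication.MatrixMultiplication.Cruxes.CommutativeRealization.Birth

open Literature.Combinatorics.AssociationSchemes
open Summit.MatrixMultiplication.MatrixMultiplication.Theses.CommutativeSchemes

/-! ## The three registered stubs -/

/-- **Stub 1 — rectangular translation designs at the cube-root exponent (OPEN; the load-bearing stub).**
For every `ε > 0` there are a finite abelian group `H`, a TRANSLATION association scheme `S` on `H` (classes
invariant under simultaneous translation `(x, y) ↦ (x + w, y + w)`; Brouwer–Cohen–Neumaier §2.10, "translation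
scheme" = S-partition / Schur ring over `H`) with class labels `Fin r`, and a shape `l·m·n ≥ 2` such that `S`
realises `⟨l, m, n⟩` (CU13 Def. 12) and `r ≤ (l·m·n)^((2+ε)/3)`. Why plausibly true: it is CU13 Conjecture 21
on the family CU13 §6.2 singles out (symmetric powers of abelian group schemes are translation schemes on
`G^k`), with the shape relaxed to rectangles; KNOWN for `ε ≥ 0.376 + o(1)` (CU13 Thm. 20: symmetric powers
of the CKSU05 / CW-type abelian STPP constructions are translation schemes realising `⟨n,n,n⟩` with
`n^(2.376+o(1)) = (n³)^((2+0.376+o(1))/3)` classes). Why it might fail: every translation design on record is a Sym-power of a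
bounded-exponent abelian STPP whose `ε → 0` limit is slice-rank-barred (BCCGNSU17), and fusion in `Z_N` may
inherit `r ≥ n^(3-o(1))` from sum–product (route crux `CyclicRealization`, why-it-might-fail). Size XL.
Sources: CohnUmans2013 = arXiv:1207.6528 (Conj. 21, Thm. 17/20, §6.2), doi:10.1007/978-3-642-74341-2 §2.10,
CohnKleinbergSzegedyUmans2005, BlasiakChurchCohnGrochowNaslundSawinUmans2017. -/
theorem stub_rectangularTranslationDesign :
    ∀ ε : ℝ, 0 < ε → ∃ (H : Type) (_ : AddCommGroup H) (_ : Fintype H) (l m n r : ℕ)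
      (S : AssociationScheme H (Fin r)),
      (∀ x y w : H, S.cls (x + w) (y + w) = S.cls x y) ∧ 2 ≤ l * m * n ∧
        (r : ℝ) ≤ ((l * m * n : ℕ) : ℝ) ^ ((2 + ε) / 3) ∧ S.Realizes l m n := by
  sorry

/-- **Stub 2 — translation schemes are commutative** (Brouwer–Cohen–Neumaier §2.10; CU13 §4.2 for group
schemes). If the classes of an association scheme on a finite abelian group `H` are translation invariant, then
`cls u v` depends only on `v - u`, and the involution `z ↦ x + y - z` of `H` maps `{z | cls x z = a ∧ cls z y = b}`
onto `{z | cls x z = b ∧ cls z y = a}`, so `p^c_{ab} = p^c_{ba}`. Why plausibly true: it is a theorem (provable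
now, `Finset.card_bij` with the involution). Size S/M. Sources: doi:10.1007/978-3-642-74341-2 §2.10,
arXiv:1207.6528 §4.2. -/
theorem stub_translationScheme_isCommutative :
    ∀ (H : Type) [AddCommGroup H] [Fintype H] (r : ℕ) (S : AssociationScheme H (Fin r)),
      (∀ x y w : H, S.cls (x + w) (y + w) = S.cls x y) → S.IsCommutative :=
  -- LANDED (p147037): Theorems/CommutativeSchemesCommutativeRealizationStubTranslationSchemeIsCommutative.lean
  Summit.MatrixMultiplication.MatrixMultiplication.Theorems.stub_translationScheme_isCommutative

/-- **Stub 3 — the cube of a commutative realisation** (CU13 §4.2 "direct product" + proof of Thm. 17, first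
paragraph: "`𝒞^k` realizes `⟨L, M, N⟩`" + the cyclic symmetry of Def. 11/12). If a commutative association
scheme `S` on `X` with labels `Fin r` realises `⟨l, m, n⟩`, then it also realises the rotations `⟨m, n, l⟩`,
`⟨n, l, m⟩` (cycle `(α, β, γ)` and `(x, y, z)`), and the direct product of the three — the scheme on `X × X × X`
whose class of `((x₁,x₂,x₃),(y₁,y₂,y₃))` is the triple of classes, commutative with `r³` labels (intersection
numbers multiply) — realises `⟨lmn, mnl, nlm⟩ = ⟨N, N, N⟩`, `N = l·m·n`, through
`α((a₁,a₂,a₃),(b₁',b₂',b₃')) = (α(a₁,b₁'), β(a₂,b₂'), γ(a₃,b₃'))` etc. after reindexing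
`Fin l × Fin m × Fin n ≃ Fin N` (triangles are componentwise). Why plausibly true: it is a theorem (provable now;
the work is the bookkeeping of the product scheme and the three equivalences). Size M/L.
Sources: arXiv:1207.6528 §4.2, Thm. 17 (proof), Def. 11/12. -/
theorem stub_commutativeRealization_cube :
    ∀ (X : Type) [Fintype X] (l m n r : ℕ) (S : AssociationScheme X (Fin r)),
      S.IsCommutative → S.Realizes l m n →
        ∃ (r' : ℕ) (T : AssociationScheme (X × X × X) (Fin r')),
          r' ≤ r ^ 3 ∧ T.IsCommutative ∧ T.Realizes (l * m * n) (l * m * n) (l * m * n) :=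
  -- LANDED (p147391): Theorems/CommutativeSchemesCommutativeRealizationStubCommutativeRealizationCube.lean
  Summit.MatrixMultiplication.MatrixMultiplication.Theorems.stub_commutativeRealization_cube

/-! ## Sorry-free composition -/

/-- **Composition with explicit hypotheses** (the BC3 shape `stub₁-sig → stub₂-sig → stub₃-sig → crux`; the
conclusion is the crux statement of the route file verbatim, i.e. `CommutativeRealization` unfolded one step).
Given `ε > 0`: stub 1 yields a translation scheme `S` on `H` realising `⟨l,m,n⟩` with `r ≤ (lmn)^((2+ε)/3)`
labels; stub 2 makes it commutative; stub 3 yields a commutative scheme `T` on `H × H × H` realising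
`⟨N,N,N⟩`, `N = lmn ≥ 2`, with `r' ≤ r³ ≤ ((lmn)^((2+ε)/3))³ = N^(2+ε)` labels; the scheme structure unpacks
into the route's inlined clauses (`cls_eq_cls_self_iff`, `exists_transpose`, `isCommutative_iff`, and
`Realizes` definitionally). Sorry-free, standard axioms. [cite: CohnUmans2013, Thm. 17] -/
theorem CommutativeRealization_of_stubs
    (hA : ∀ ε : ℝ, 0 < ε → ∃ (H : Type) (_ : AddCommGroup H) (_ : Fintype H) (l m n r : ℕ)
      (S : AssociationScheme H (Fin r)),
      (∀ x y w : H, S.cls (x + w) (y + w) = S.cls x y) ∧ 2 ≤ l * m * n ∧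
        (r : ℝ) ≤ ((l * m * n : ℕ) : ℝ) ^ ((2 + ε) / 3) ∧ S.Realizes l m n)
    (hB : ∀ (H : Type) [AddCommGroup H] [Fintype H] (r : ℕ) (S : AssociationScheme H (Fin r)),
      (∀ x y w : H, S.cls (x + w) (y + w) = S.cls x y) → S.IsCommutative)
    (hC : ∀ (X : Type) [Fintype X] (l m n r : ℕ) (S : AssociationScheme X (Fin r)),
      S.IsCommutative → S.Realizes l m n →
        ∃ (r' : ℕ) (T : AssociationScheme (X × X × X) (Fin r')),
          r' ≤ r ^ 3 ∧ T.IsCommutative ∧ T.Realizes (l * m * n) (l * m * n) (l * m * n)) :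
    ∀ ε : ℝ, 0 < ε → ∃ n : ℕ, 2 ≤ n ∧ ∃ (X : Type) (_ : Fintype X) (r : ℕ) (cls : X → X → Fin r),
      (r : ℝ) ≤ (n : ℝ) ^ (2 + ε) ∧ (∀ x y z : X, cls x y = cls z z ↔ x = y) ∧
      (∃ τ : Fin r → Fin r, ∀ x y : X, cls y x = τ (cls x y)) ∧
      (∃ p : Fin r → Fin r → Fin r → ℕ, (∀ (a b : Fin r) (x y : X),
        (Finset.univ.filter (fun z : X => cls x z = a ∧ cls z y = b)).card = p a b (cls x y)) ∧
          ∀ a b c : Fin r, p a b c = p b a c) ∧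
      ∃ α β γ : Fin n × Fin n → Fin r, Function.Injective α ∧ Function.Injective β ∧
        Function.Injective γ ∧ ∀ a a' b b' c c' : Fin n,
          ((∃ x y z : X, cls x y = α (a, b') ∧ cls y z = β (b, c') ∧ cls z x = γ (c, a')) ↔
            (a = a' ∧ b = b' ∧ c = c')) := by
  intro ε hε
  obtain ⟨H, _instG, _instF, l, m, n, r, S, htrans, h2, hr, hreal⟩ := hA ε hε
  have hcomm : S.IsCommutative := hB H r S htrans
  obtain ⟨r', T, hr', hTcomm, hTreal⟩ := hC H l m n r S hcomm hreal
  refine ⟨l * m * n, h2, H × H × H, inferInstance, r', T.cls, ?_, T.cls_eq_cls_self_iff,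
    T.exists_transpose, T.isCommutative_iff.1 hTcomm, hTreal⟩
  -- the count: `r' ≤ r³ ≤ ((lmn)^((2+ε)/3))³ = (lmn)^(2+ε)`
  have h0 : (0 : ℝ) ≤ ((l * m * n : ℕ) : ℝ) := Nat.cast_nonneg _
  have h1 : (r' : ℝ) ≤ (r : ℝ) ^ (3 : ℕ) := by exact_mod_cast hr'
  have h2' : (r : ℝ) ^ (3 : ℕ) ≤ (((l * m * n : ℕ) : ℝ) ^ ((2 + ε) / 3)) ^ (3 : ℕ) :=
    pow_le_pow_left₀ (Nat.cast_nonneg r) hr 3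
  have h3 : (((l * m * n : ℕ) : ℝ) ^ ((2 + ε) / 3)) ^ (3 : ℕ) = ((l * m * n : ℕ) : ℝ) ^ (2 + ε) := by
    rw [← Real.rpow_natCast, ← Real.rpow_mul h0]
    congr 1
    push_cast
    ring
  calc (r' : ℝ) ≤ (r : ℝ) ^ (3 : ℕ) := h1
    _ ≤ (((l * m * n : ℕ) : ℝ) ^ ((2 + ε) / 3)) ^ (3 : ℕ) := h2'
    _ = ((l * m * n : ℕ) : ℝ) ^ (2 + ε) := h3

/-! ## The skeleton theorem: the crux BY NAME -/

/-- **THE SKELETON THEOREM.** The crux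
`Summit.MatrixMultiplication.MatrixMultiplication.Theses.CommutativeSchemes.CommutativeRealization`
(stmt-MatrixMultiplication-9462, CU13 Conjecture 21 in ε-form), concluded BY NAME from the three DECLARED stubs
`stub_rectangularTranslationDesign`, `stub_translationScheme_isCommutative`, `stub_commutativeRealization_cube`
(the only `sorry`s of the file) through the sorry-free composition `CommutativeRealization_of_stubs`.
[cite: CohnUmans2013, Conj. 21] -/
theorem CommutativeRealization_of :
    Summit.MatrixMultiplication.MatrixMultiplication.Theses.CommutativeSchemes.CommutativeRealization :=
  CommutativeRealization_of_stubs stub_rectangularTranslationDesign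
    stub_translationScheme_isCommutative stub_commutativeRealization_cube

end Summit.MatrixMultiplication.MatrixMultiplication.Cruxes.CommutativeRealization.Birth
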